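import Literature.AlgebraicGeometry.Motives.WeilDiscriminantRealization
import Literature.AlgebraicGeometry.Motives.WeilDiscriminantProduct

/-!
# `WeilTenfoldsSqrtMinus11` (stmt-HodgeConjecture-1262) · Negative · tightness of the line stub `stub_aimingArithmetic`

Negative-side knowledge for the crux `HeckePrymWeil.WeilTenfoldsSqrtMinus11`, from the standing disprover's work
file `Cruxes/WeilTenfoldsSqrtMinus11/Disproof.lean` §I (refuter-cdisprove-stmt-HodgeConjecture-1262-g3-0, cycle 3,
2026-08-16). The PICKED line `generic-ppav-secant-descent` (skeleton `Lines/generic-ppav-secant-descent.lean`,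
sha 7545e3bc) has a stub `stub_aimingArithmetic` — the "free-weights lever" of the one-class descent, a statement of
pure `ℚ(√-11)`-Hermitian linear algebra (Landherr from Meyer): for a Weil-type alternating form `E` on a `2n`-dimensional
`K`-space whose Hermitian form has signature `(n, n)`, and weights `r₁ r₂ > 0`, some orthogonal sum
`E ⊕ E_{(m₁r₁, -m₂r₂)}` is hyperbolic. Two `_false_without_` theorems, valid in EVERY model `K` of `ℚ(√-11)`
(no field is constructed; `K`, `α`, `hK` are the stub's own binders):

* `aiming_false_without_signature` — delete the signature block: FALSE at `n = 1`, `V = K²`, `E = E_{(1,1)}`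
  (positive definite), `r₁ = r₂ = 1`: the sum has signature `(3,1)` and no `K`-plane is totally isotropic.
* `aiming_false_without_sign` — delete `0 < r₁ r₂` (keep the signature block, witnessed by `signature_one_one`):
  FALSE at `E = E_{(1,-1)}`, `(r₁, r₂) = (1, -1)`: the binary summand `⟨m₁, m₂⟩` is positive definite for all
  admissible weights, the sum has signature `(3,1)` again.

Both proofs: a `K`-plane `L` meets the kernel of one coordinate functional non-trivially
(`LinearMap.ker_ne_bot_of_finrank_lt`), and on that vector `0 = E'(x, αx) = Σ cᵢ Nm(xᵢ)` with all `cᵢ > 0`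
(`diagWeilForm_self_alpha`: the Hermitian form of `diagWeilForm c` is `diag(c)·Nm`, `Nm = re² + 11·im²`), forcing
`x = 0`. Consequence for the prover of the stub: both hypotheses are USED by any proof; the equal-weight witness of the
`n = 0` sanity check (item evidence `AimingZero.lean`) does not generalise. Pure linear algebra over the tree's
`Motives.diagWeilForm` / `bilinOrthSum`; no new definition.
-/

noncomputable section

namespace Summit.HodgeConjecture.HodgeConjecture.Theorems.WeilTenfoldsSqrtMinus11.Negative

open Literature.AlgebraicGeometry.Motives

variable {K : Type} [Field K] [Algebra ℚ K] {α : K}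
  (hα : α * α = algebraMap ℚ K (-11))
  (hK : ∀ k : K, ∃ a b : ℚ, k = algebraMap ℚ K a + algebraMap ℚ K b * α)

/-- `0 < 11` in `ℚ` (the `hd` argument of `Motives/WeilDiscriminantRealization` at `d = 11`). [folklore] -/
theorem eleven_pos : (0 : ℚ) < 11 := by norm_num

/-- The norm form `Nm z = (re z)² + 11 (im z)²` of `K = ℚ + ℚα` is non-negative. [folklore] -/
theorem normForm_nonneg (z : K) :
    0 ≤ reCoord eleven_pos hα hK z ^ 2 + 11 * imCoord eleven_pos hα hK z ^ 2 := by
  positivity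

/-- … and vanishes only at `z = 0` (`z = re z + (im z) α`). [folklore] -/
theorem eq_zero_of_normForm_eq_zero {z : K}
    (hz : reCoord eleven_pos hα hK z ^ 2 + 11 * imCoord eleven_pos hα hK z ^ 2 = 0) : z = 0 := by
  have h1 := sq_nonneg (reCoord eleven_pos hα hK z)
  have h2 := sq_nonneg (imCoord eleven_pos hα hK z)
  have hr : reCoord eleven_pos hα hK z = 0 := by
    nlinarith
  have hi : imCoord eleven_pos hα hK z = 0 := by
    nlinarith
  rw [eq_reCoord_add_imCoord eleven_pos hα hK z, hr, hi, map_zero, zero_mul, add_zero]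

/-- `Nm 0 = 0`. [folklore] -/
theorem normForm_zero :
    reCoord eleven_pos hα hK (0 : K) ^ 2 + 11 * imCoord eleven_pos hα hK (0 : K) ^ 2 = 0 := by
  simp

/-- `z ≠ 0 → 0 < Nm z`. [folklore] -/
theorem normForm_pos {z : K} (hz : z ≠ 0) :
    0 < reCoord eleven_pos hα hK z ^ 2 + 11 * imCoord eleven_pos hα hK z ^ 2 :=
  lt_of_le_of_ne (normForm_nonneg hα hK z) fun h => hz (eq_zero_of_normForm_eq_zero hα hK h.symm)

/-- **`H(x, x) = E_c(x, α x) = Σ cᵢ Nm(xᵢ)`** for the diagonal Weil form on `K²` in the standard basis: the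
Hermitian form of `diagWeilForm c` is `diag(c) · Nm` (van Geemen's normal form). [cite: vanGeemen1994HodgeAV, 5.4 (5.4.1)] -/
theorem diagWeilForm_self_alpha (c : Fin 2 → ℚ) (x : Fin 2 → K) :
    diagWeilForm eleven_pos hα hK (Pi.basisFun K (Fin 2)) c x (α • x) =
      c 0 * (reCoord eleven_pos hα hK (x 0) ^ 2 + 11 * imCoord eleven_pos hα hK (x 0) ^ 2) +
        c 1 * (reCoord eleven_pos hα hK (x 1) ^ 2 + 11 * imCoord eleven_pos hα hK (x 1) ^ 2) := by
  rw [diagWeilForm_apply, Fin.sum_univ_two]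
  have hc : ∀ i, (Pi.basisFun K (Fin 2)).coord i (α • x) = α * (Pi.basisFun K (Fin 2)).coord i x :=
    fun i => coord_alpha_smul _ i x
  have hx : ∀ i, (Pi.basisFun K (Fin 2)).coord i x = x i := fun i => by
    rw [Module.Basis.coord_apply, Pi.basisFun_repr]
  simp only [hc, reCoord_alpha_mul, imCoord_alpha_mul, hx]
  ring

/-- **`stub_aimingArithmetic` WITHOUT its signature block is FALSE** (every model `K` of `ℚ(√-11)`): `n = 1`,
`V = K²`, the DEFINITE Weil form `E = E_{(1,1)}` (all other hypotheses hold: alternating, Weil identity,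
`finrank = 2·1`), `r₁ = r₂ = 1`; for any weights `m₁, m₂ > 0` the summed Hermitian form
`Nm ⊕ Nm ⊕ m₁Nm ⊕ (-m₂)Nm` has signature `(3,1)`: a `K`-plane `L ≤ K² × K²` contains a non-zero vector with
vanishing last coordinate, on which `0 = E'(x, αx) = Nm(x₁) + Nm(x₂) + m₁ Nm(x₃)` forces `x = 0`. So any proof of
the stub uses the signature hypothesis `(P, N)`. [folklore] -/
theorem aiming_false_without_signature :
    ¬ (∀ (V : Type) [AddCommGroup V] [Module ℚ V] [Module K V] [IsScalarTower ℚ K V]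
        [Module.Finite K V] (n : ℕ), Module.finrank K V = 2 * n →
      ∀ (E : LinearMap.BilinForm ℚ V), (∀ x y : V, E x y = -E y x) →
        (∀ x y : V, E (α • x) (α • y) = 11 * E x y) →
      ∀ r₁ r₂ : ℚ, 0 < r₁ * r₂ →
        ∃ m₁ m₂ : ℕ, 0 < m₁ ∧ 0 < m₂ ∧
          ∃ L : Submodule K (V × (Fin 2 → K)), Module.finrank K L = n + 1 ∧
            ∀ x ∈ L, ∀ y ∈ L,
              bilinOrthSum E
                (diagWeilForm (d := 11) (by norm_num) hα hK (Pi.basisFun K (Fin 2))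
                  ![(m₁ : ℚ) * r₁, -((m₂ : ℚ) * r₂)]) x y = 0) := by
  intro h
  have hE1 : ∀ x y : Fin 2 → K, diagWeilForm eleven_pos hα hK (Pi.basisFun K (Fin 2)) ![1, 1] x y =
      -diagWeilForm eleven_pos hα hK (Pi.basisFun K (Fin 2)) ![1, 1] y x :=
    fun x y => by rw [diagWeilForm_swap _ _ _ _ _ y x]
  have hE2 : ∀ x y : Fin 2 → K,
      diagWeilForm eleven_pos hα hK (Pi.basisFun K (Fin 2)) ![1, 1] (α • x) (α • y) =
        11 * diagWeilForm eleven_pos hα hK (Pi.basisFun K (Fin 2)) ![1, 1] x y :=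
    fun x y => diagWeilForm_smul_smul _ _ _ _ _ x y
  obtain ⟨m₁, m₂, hm₁, _, L, hL, hiso⟩ :=
    h (Fin 2 → K) 1 (by simp) _ hE1 hE2 1 1 (by norm_num)
  -- a non-zero vector of `L` with vanishing last coordinate
  let f : L →ₗ[K] K :=
    ((LinearMap.proj 1 : (Fin 2 → K) →ₗ[K] K).comp (LinearMap.snd K (Fin 2 → K) (Fin 2 → K))).comp
      L.subtype
  have hker : LinearMap.ker f ≠ ⊥ :=
    LinearMap.ker_ne_bot_of_finrank_lt (by rw [hL, Module.finrank_self]; norm_num)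
  obtain ⟨x, hx, hx0⟩ := Submodule.exists_mem_ne_zero_of_ne_bot hker
  have hx4 : (x : (Fin 2 → K) × (Fin 2 → K)).2 1 = 0 := by
    simpa [f] using hx
  -- evaluate the summed form at `(x, α x)`
  have h0 := hiso x x.2 (α • (x : (Fin 2 → K) × (Fin 2 → K))) (L.smul_mem α x.2)
  rw [bilinOrthSum_apply, Prod.smul_fst, Prod.smul_snd, diagWeilForm_self_alpha,
    diagWeilForm_self_alpha] at h0
  simp only [Matrix.cons_val_zero, Matrix.cons_val_one, one_mul] at h0
  rw [hx4, normForm_zero, mul_zero, add_zero] at h0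
  have h1 := normForm_nonneg hα hK ((x : (Fin 2 → K) × (Fin 2 → K)).1 0)
  have h2 := normForm_nonneg hα hK ((x : (Fin 2 → K) × (Fin 2 → K)).1 1)
  have h3 := normForm_nonneg hα hK ((x : (Fin 2 → K) × (Fin 2 → K)).2 0)
  have hm₁' : (0 : ℚ) < m₁ := by exact_mod_cast hm₁
  have e1 : reCoord eleven_pos hα hK ((x : (Fin 2 → K) × (Fin 2 → K)).1 0) ^ 2 +
      11 * imCoord eleven_pos hα hK ((x : (Fin 2 → K) × (Fin 2 → K)).1 0) ^ 2 = 0 := by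
    nlinarith [mul_nonneg hm₁'.le h3]
  have e2 : reCoord eleven_pos hα hK ((x : (Fin 2 → K) × (Fin 2 → K)).1 1) ^ 2 +
      11 * imCoord eleven_pos hα hK ((x : (Fin 2 → K) × (Fin 2 → K)).1 1) ^ 2 = 0 := by
    nlinarith [mul_nonneg hm₁'.le h3]
  have e3 : reCoord eleven_pos hα hK ((x : (Fin 2 → K) × (Fin 2 → K)).2 0) ^ 2 +
      11 * imCoord eleven_pos hα hK ((x : (Fin 2 → K) × (Fin 2 → K)).2 0) ^ 2 = 0 := by
    have : (m₁ : ℚ) * (reCoord eleven_pos hα hK ((x : (Fin 2 → K) × (Fin 2 → K)).2 0) ^ 2 +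
        11 * imCoord eleven_pos hα hK ((x : (Fin 2 → K) × (Fin 2 → K)).2 0) ^ 2) = 0 := by
      nlinarith [mul_nonneg hm₁'.le h3]
    exact (mul_eq_zero.1 this).resolve_left hm₁'.ne'
  apply hx0
  have hx' : (x : (Fin 2 → K) × (Fin 2 → K)) = 0 := by
    refine Prod.ext (funext fun i => ?_) (funext fun i => ?_)
    · fin_cases i
      · exact eq_zero_of_normForm_eq_zero hα hK e1
      · exact eq_zero_of_normForm_eq_zero hα hK e2
    · fin_cases i
      · exact eq_zero_of_normForm_eq_zero hα hK e3
      · exact hx4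
  exact (Submodule.coe_eq_zero (x := x)).1 hx'

/-- The standard Weil plane `K²` with `E = E_{(1,-1)}` satisfies the stub's signature block with `n = 1`:
`P = K·e₀` (positive), `N = K·e₁` (negative). [folklore] -/
theorem signature_one_one :
    ∃ P N : Submodule K (Fin 2 → K), Module.finrank K P = 1 ∧ Module.finrank K N = 1 ∧ P ⊓ N = ⊥ ∧
      (∀ x ∈ P, x ≠ 0 →
        0 < diagWeilForm eleven_pos hα hK (Pi.basisFun K (Fin 2)) ![1, -1] x (α • x)) ∧
      (∀ x ∈ N, x ≠ 0 →
        diagWeilForm eleven_pos hα hK (Pi.basisFun K (Fin 2)) ![1, -1] x (α • x) < 0) := by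
  refine ⟨K ∙ (Pi.single 0 1), K ∙ (Pi.single 1 1), ?_, ?_, ?_, ?_, ?_⟩
  · exact finrank_span_singleton (by simp)
  · exact finrank_span_singleton (by simp)
  · rw [Submodule.eq_bot_iff]
    intro x hx
    rw [Submodule.mem_inf, Submodule.mem_span_singleton, Submodule.mem_span_singleton] at hx
    obtain ⟨⟨a, ha⟩, ⟨b, hb⟩⟩ := hx
    have h0 : x 0 = 0 := by rw [← hb]; simp
    have h1 : x 1 = 0 := by rw [← ha]; simp
    funext i; fin_cases i <;> assumption
  · intro x hx hx0
    rw [Submodule.mem_span_singleton] at hx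
    obtain ⟨a, rfl⟩ := hx
    have ha : a ≠ 0 := by rintro rfl; exact hx0 (by simp)
    rw [diagWeilForm_self_alpha]
    simp only [Matrix.cons_val_zero, Matrix.cons_val_one, Pi.smul_apply, Pi.single_eq_same,
      Pi.single_eq_of_ne (show (1 : Fin 2) ≠ 0 by decide), smul_eq_mul, mul_one, mul_zero, one_mul]
    rw [normForm_zero]
    have := normForm_pos hα hK ha
    linarith
  · intro x hx hx0
    rw [Submodule.mem_span_singleton] at hx
    obtain ⟨a, rfl⟩ := hx
    have ha : a ≠ 0 := by rintro rfl; exact hx0 (by simp)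
    rw [diagWeilForm_self_alpha]
    simp only [Matrix.cons_val_zero, Matrix.cons_val_one, Pi.smul_apply, Pi.single_eq_same,
      Pi.single_eq_of_ne (show (0 : Fin 2) ≠ 1 by decide), smul_eq_mul, mul_one, mul_zero, one_mul]
    rw [normForm_zero]
    have := normForm_pos hα hK ha
    linarith

/-- **`stub_aimingArithmetic` WITHOUT `0 < r₁ r₂` is FALSE** (every model `K` of `ℚ(√-11)`): with ALL other
hypotheses in force (`n = 1`, `V = K²`, `E = E_{(1,-1)}` of signature `(1,1)`, `signature_one_one`), the weights
`(r₁, r₂) = (1, -1)` make the binary summand `⟨m₁, m₂⟩` POSITIVE DEFINITE for every `m₁, m₂ > 0`; the sum has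
signature `(3,1)` and no `K`-plane is totally isotropic (kernel vector of the negative `V`-coordinate, then
`Nm(x₁) + m₁Nm(x₃) + m₂Nm(x₄) = 0`). So the sign condition is load-bearing as well. [folklore] -/
theorem aiming_false_without_sign :
    ¬ (∀ (V : Type) [AddCommGroup V] [Module ℚ V] [Module K V] [IsScalarTower ℚ K V]
        [Module.Finite K V] (n : ℕ), Module.finrank K V = 2 * n →
      ∀ (E : LinearMap.BilinForm ℚ V), (∀ x y : V, E x y = -E y x) →
        (∀ x y : V, E (α • x) (α • y) = 11 * E x y) →
        (∃ P N : Submodule K V, Module.finrank K P = n ∧ Module.finrank K N = n ∧ P ⊓ N = ⊥ ∧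
          (∀ x ∈ P, x ≠ 0 → 0 < E x (α • x)) ∧ (∀ x ∈ N, x ≠ 0 → E x (α • x) < 0)) →
      ∀ r₁ r₂ : ℚ,
        ∃ m₁ m₂ : ℕ, 0 < m₁ ∧ 0 < m₂ ∧
          ∃ L : Submodule K (V × (Fin 2 → K)), Module.finrank K L = n + 1 ∧
            ∀ x ∈ L, ∀ y ∈ L,
              bilinOrthSum E
                (diagWeilForm (d := 11) (by norm_num) hα hK (Pi.basisFun K (Fin 2))
                  ![(m₁ : ℚ) * r₁, -((m₂ : ℚ) * r₂)]) x y = 0) := by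
  intro h
  have hE1 : ∀ x y : Fin 2 → K, diagWeilForm eleven_pos hα hK (Pi.basisFun K (Fin 2)) ![1, -1] x y =
      -diagWeilForm eleven_pos hα hK (Pi.basisFun K (Fin 2)) ![1, -1] y x :=
    fun x y => by rw [diagWeilForm_swap _ _ _ _ _ y x]
  have hE2 : ∀ x y : Fin 2 → K,
      diagWeilForm eleven_pos hα hK (Pi.basisFun K (Fin 2)) ![1, -1] (α • x) (α • y) =
        11 * diagWeilForm eleven_pos hα hK (Pi.basisFun K (Fin 2)) ![1, -1] x y :=
    fun x y => diagWeilForm_smul_smul _ _ _ _ _ x y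
  obtain ⟨m₁, m₂, hm₁, hm₂, L, hL, hiso⟩ :=
    h (Fin 2 → K) 1 (by simp) _ hE1 hE2 (signature_one_one hα hK) 1 (-1)
  -- a non-zero vector of `L` with vanishing second (negative) `V`-coordinate
  let f : L →ₗ[K] K :=
    ((LinearMap.proj 1 : (Fin 2 → K) →ₗ[K] K).comp (LinearMap.fst K (Fin 2 → K) (Fin 2 → K))).comp
      L.subtype
  have hker : LinearMap.ker f ≠ ⊥ :=
    LinearMap.ker_ne_bot_of_finrank_lt (by rw [hL, Module.finrank_self]; norm_num)
  obtain ⟨x, hx, hx0⟩ := Submodule.exists_mem_ne_zero_of_ne_bot hker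
  have hx2 : (x : (Fin 2 → K) × (Fin 2 → K)).1 1 = 0 := by
    simpa [f] using hx
  have h0 := hiso x x.2 (α • (x : (Fin 2 → K) × (Fin 2 → K))) (L.smul_mem α x.2)
  rw [bilinOrthSum_apply, Prod.smul_fst, Prod.smul_snd, diagWeilForm_self_alpha,
    diagWeilForm_self_alpha] at h0
  simp only [Matrix.cons_val_zero, Matrix.cons_val_one, one_mul, mul_one, mul_neg, neg_neg] at h0
  rw [hx2, normForm_zero] at h0
  have h1 := normForm_nonneg hα hK ((x : (Fin 2 → K) × (Fin 2 → K)).1 0)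
  have h3 := normForm_nonneg hα hK ((x : (Fin 2 → K) × (Fin 2 → K)).2 0)
  have h4 := normForm_nonneg hα hK ((x : (Fin 2 → K) × (Fin 2 → K)).2 1)
  have hm₁' : (0 : ℚ) < m₁ := by exact_mod_cast hm₁
  have hm₂' : (0 : ℚ) < m₂ := by exact_mod_cast hm₂
  have e1 : reCoord eleven_pos hα hK ((x : (Fin 2 → K) × (Fin 2 → K)).1 0) ^ 2 +
      11 * imCoord eleven_pos hα hK ((x : (Fin 2 → K) × (Fin 2 → K)).1 0) ^ 2 = 0 := by
    nlinarith [mul_nonneg hm₁'.le h3, mul_nonneg hm₂'.le h4]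
  have e3 : reCoord eleven_pos hα hK ((x : (Fin 2 → K) × (Fin 2 → K)).2 0) ^ 2 +
      11 * imCoord eleven_pos hα hK ((x : (Fin 2 → K) × (Fin 2 → K)).2 0) ^ 2 = 0 := by
    have : (m₁ : ℚ) * (reCoord eleven_pos hα hK ((x : (Fin 2 → K) × (Fin 2 → K)).2 0) ^ 2 +
        11 * imCoord eleven_pos hα hK ((x : (Fin 2 → K) × (Fin 2 → K)).2 0) ^ 2) = 0 := by
      nlinarith [mul_nonneg hm₁'.le h3, mul_nonneg hm₂'.le h4]
    exact (mul_eq_zero.1 this).resolve_left hm₁'.ne'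
  have e4 : reCoord eleven_pos hα hK ((x : (Fin 2 → K) × (Fin 2 → K)).2 1) ^ 2 +
      11 * imCoord eleven_pos hα hK ((x : (Fin 2 → K) × (Fin 2 → K)).2 1) ^ 2 = 0 := by
    have : (m₂ : ℚ) * (reCoord eleven_pos hα hK ((x : (Fin 2 → K) × (Fin 2 → K)).2 1) ^ 2 +
        11 * imCoord eleven_pos hα hK ((x : (Fin 2 → K) × (Fin 2 → K)).2 1) ^ 2) = 0 := by
      nlinarith [mul_nonneg hm₁'.le h3, mul_nonneg hm₂'.le h4]
    exact (mul_eq_zero.1 this).resolve_left hm₂'.ne'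
  apply hx0
  have hx' : (x : (Fin 2 → K) × (Fin 2 → K)) = 0 := by
    refine Prod.ext (funext fun i => ?_) (funext fun i => ?_)
    · fin_cases i
      · exact eq_zero_of_normForm_eq_zero hα hK e1
      · exact hx2
    · fin_cases i
      · exact eq_zero_of_normForm_eq_zero hα hK e3
      · exact eq_zero_of_normForm_eq_zero hα hK e4
  exact (Submodule.coe_eq_zero (x := x)).1 hx'

end Summit.HodgeConjecture.HodgeConjecture.Theorems.WeilTenfoldsSqrtMinus11.Negative

end
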